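import Summits.QuantumFields.YangMills.Theorems.CovariantDischargeSandwichLargeBase
import HarnessLib

/-!
# Crux `HistoryTailL` (stmt-QuantumFields-19936) — REGISTERED STUB `stub_sandwichLargeBase` BY NAME
# (skeleton v5 `Cruxes/HistoryTailL/Lines/sandwich_discharge.lean` 470b3af6f9aa, ideator line «sandwich_discharge» /
# route-QuantumFields-CovariantDischarge; the stub text = the statement of `CovariantDischargeSandwichLargeBase.sandwichTail_of_large_base`
# (✓p709664, landed as a helper seconds before the v5 registration) TOKEN FOR TOKEN — this file gives the registry its by-name inhabitant)

Cell `ym3-torus` (YM ladder rung R3 = continuum SU(2) Yang–Mills on the three-torus; NOT the Clay problem), width seat `ym-ust-19936-w5` gen 13.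

WHAT THIS IS NOT.  Pure aliasing (`:= sandwichTail_of_large_base`); the content is in `CovariantDischargeSandwichLargeBase` (footprint locality +
per-fine-plaquette chessboard + the large-base arithmetic).  The load-bearing capped sweep `stub_sandwichSweepGapCapped` and the residual
`stub_sandwichDeep` stay OPEN; nothing of `HistoryTailL` or the rung is proved.  YM₃ on T³ is rung R3, NOT the Clay problem.

References: T. Bałaban, CMP **98** (1985) 17–51 [Balaban1985Averaging] (Prop. 1 (51) p.26); CMP **102** (1985) 255–275 [Balaban1985UV3] ((7) p.257,
(71) p.273); J. Fröhlich, R. Israel, E. Lieb, B. Simon, CMP 62 (1978) [FrohlichIsraelLiebSimon1978] (Thm 4.1).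
-/

noncomputable section

open MeasureTheory
open Literature.MathematicalPhysics.QuantumFieldTheory.Balaban1983to89
open Literature.MathematicalPhysics.QuantumFieldTheory.Balaban1983to89.T3ContinuumYM3Torus

namespace Summit.QuantumFields.YangMills.Theorems.CovariantDischargeSandwichLargeBaseStub

/-- **REGISTERED STUB `stub_sandwichLargeBase` (skeleton v5 470b3af6f9aa), BY NAME**: the sandwich piece at large ladder base `2·(151L²)^j·b₀ ≤ b`,
every height `j + n ≤ K`, no coupling, no regime — `:= CovariantDischargeSandwichLargeBase.sandwichTail_of_large_base` (✓p709664).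
[cite: Balaban1985Averaging, Prop. 1 (51) p.26; Balaban1985UV3, (7) p.257 and (71) p.273; FrohlichIsraelLiebSimon1978, Thm 4.1] -/
theorem stub_sandwichLargeBase : (∀ (L : ℕ) (b₀ p₀ Λ : ℝ), 0 < b₀ → 2 < p₀ → 1 < Λ → ∃ (γ₁ C c : ℝ) (N : ℕ), 0 < γ₁ ∧ γ₁ ≤ 1 ∧ 0 < c ∧ ∀ (F : T3Family) (γ : ℝ), F.L = L → 0 < γ → γ ≤ γ₁ → ∀ (b : ℝ), b₀ ≤ b → ∀ (K n j : ℕ), j + n ≤ K → 2 * (151 * (L : ℝ) ^ 2) ^ j * b₀ ≤ b → ∀ p : Plaq (F.P K) j, (T3UnitScaleTilt.gibbsK F T3UnitLawDensityEML.ℰp γ K).real {U | (∀ k, k < j → PlaqSmall (T3UnitScaleTilt.θBal F.L γ b p₀ (K - k)) (Averaging.iter (fun i => BlockAveraging.blockAvg (P := F.P K) (j := i) T3UnitLawDensityEML.ℰp) k U)) ∧ (∀ j', j ≤ j' → j' + n ≤ K → PlaqSmall (T3UnitScaleTilt.θBal F.L γ (Λ * b) p₀ (K - j')) (Averaging.iter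 (fun i => BlockAveraging.blockAvg (P := F.P K) (j := i) T3UnitLawDensityEML.ℰp) j' U)) ∧ T3UnitScaleTilt.θBal F.L γ b p₀ (K - j) ≤ GaugeGroup.dist1 (GaugeField.plaqHol (Averaging.iter (fun i => BlockAveraging.blockAvg (P := F.P K) (j := i) T3UnitLawDensityEML.ℰp) j U) p)} ≤ C * ((γ * ((F.L : ℝ)⁻¹) ^ (K - j))⁻¹) ^ N * Real.exp (-(c * B10.pFun b₀ p₀ (Real.sqrt (γ * ((F.L : ℝ)⁻¹) ^ (K - j))) ^ 2))) :=
  Summit.QuantumFields.YangMills.Theorems.CovariantDischargeSandwichLargeBase.sandwichTail_of_large_base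

end Summit.QuantumFields.YangMills.Theorems.CovariantDischargeSandwichLargeBaseStub

end
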